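import Literature.NumberTheory.FaltingsSerre.ConjCertificate
import HarnessLib

/-!
# The Jacobian of `C₂₇₇` is paramodular of level `277` away from `277`, from a certificate up to a residual change of frame

[BPPTVY] = A. Brumer, A. Pacetti, C. Poor, G. Tornaría, J. Voight, D. S. Yuen, *On the paramodularity of
typical abelian surfaces*, Algebra & Number Theory **13**:5 (2019) 1145–1195 [cite: BrumerEtAl2019].

The `N = 277` instance of the frame-free template `paramodular_of_surfaceConjCertificate_holds`
(`ConjCertificate.lean`), companion of `Paramodular277.paramodular_277` /
`ParamodularUnconditional.paramodular_277_holds`: the certificate hypothesis is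
`ConjCertificate277 ν ρA ρf := SurfaceConjCertificate 277 data277.checkPrimes.toFinset ν ρA ρf` — Gram
matrix fixed to `J = antiIdAlt4 ℤ_[2]`, the thirteen printed check primes
`{3,5,7,11,13,17,19,23,29,31,37,41,43}` of [BPPTVY, Thm 7.1.3 p. 1188] (`data277.checkPrimes`), and Step 1
as residual conjugacy inside `ι(S₆)` (image `S₅(b)`, [BPPTVY, §7.1]: Route T, constructor
`ConjCertificate.ofTransvection`).  The input `hρf` ([BPPTVY, Thm 4.3.4 + Lemma 4.3.8(b) p. 1171]) is about `ρf`
in its own frame; the criterion is discharged by `traceEq_of_faltingsSerre_symplectic_holds`.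
-/

noncomputable section

namespace Literature.NumberTheory.FaltingsSerre.Paramodular277

open Polynomial IsDedekindDomain
open Literature.NumberTheory.FaltingsSerre Literature.NumberTheory.GaloisRepresentations
  Literature.NumberTheory.Automorphic.Paramodular Literature.NumberTheory.Automorphic
  Literature.AlgebraicGeometry.Motives
open scoped NumberField

/-- **The `N = 277` certificate up to frame, as a hypothesis**:
`SurfaceConjCertificate 277 data277.checkPrimes.toFinset ν ρA ρf`. [cite: BrumerEtAl2019, Thm 7.1.3 pp. 1187–1188; §2.3 p. 1149] -/
def ConjCertificate277 (ν : Field.absoluteGaloisGroup ℚ → ℤ_[2]) (ρA ρf : FramedGaloisRep ℚ ℤ_[2] 4) :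
    Prop :=
  SurfaceConjCertificate 277 data277.checkPrimes.toFinset ν ρA ρf

/-- A strict `Certificate277` with `J = antiIdAlt4 ℤ_[2]` gives one up to frame. [cite: BrumerEtAl2019, Thm 7.1.3 p. 1187] -/
theorem conjCertificate277_of_certificate277 {ν : Field.absoluteGaloisGroup ℚ → ℤ_[2]}
    {ρA ρf : FramedGaloisRep ℚ ℤ_[2] 4} (hC : Certificate277 (GSp4F2.antiIdAlt4 ℤ_[2]) ν ρA ρf) :
    ConjCertificate277 ν ρA ρf :=
  ConjCertificate.ofCertificate ((certificate277_iff _ _ _ _).1 hC)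

/-- **`Jac(C₂₇₇)` is paramodular of level `277` away from `277`, from the certificate up to frame —
criterion discharged.**  Binders as in `paramodular_277_holds` except `hC : ConjCertificate277 ν ρA ρf` and
`hρf` about `ρf` in its own frame. [cite: BrumerEtAl2019, Thm 1.2.1 pp. 1146–1147; Thm 7.1.3 p. 1187; §2.3 p. 1149; Thm 4.3.4 p. 1169] -/
theorem paramodular_277_of_conjCertificate
    {A : AbelianVariety ℚ} {f : Matrix (Fin 2) (Fin 2) ℂ → ℂ}
    {ρA ρf : FramedGaloisRep ℚ ℤ_[2] 4} {ν : Field.absoluteGaloisGroup ℚ → ℤ_[2]}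
    {b : Module.Basis (Fin 4) ℚ_[2] (A.rationalTateModule 2)}
    (hC : ConjCertificate277 ν ρA ρf)
    (hframe : A.IsFrameOfTateRep 2 b (rationalize ρA))
    (aA bA af bf : ℕ → ℤ)
    (hA : ∀ p : ℕ, p.Prime → ¬ p ∣ 277 →
      A.HasGoodEulerFactorAt p ((lPolynomialOfSurface p (aA p) (bA p)).map (Int.castRingHom ℚ)))
    (hρf : ∀ p : ℕ, p.Prime → ¬ p ∣ 277 → p ≠ 2 →
      ∀ v : HeightOneSpectrum (𝓞 ℚ), ((p : ℕ) : 𝓞 ℚ) ∈ v.asIdeal →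
        ρf.HasFrobCharpolyAt v
          ((lPolynomialOfSurface p (af p) (bf p)).reverse.map (Int.castRingHom ℤ_[2])))
    (hcusp : IsParamodularCuspForm 277 2 f) (hne : ∃ Z ∈ siegelUpperHalfSpace 2, f Z ≠ 0)
    (hfe : ∀ p : ℕ, p.Prime → ¬ p ∣ 277 →
      HasSpinorEulerFactorAt 2 p f ((lPolynomialOfSurface p (af p) (bf p)).map (Int.castRingHom ℂ)))
    (h2 : aA 2 = af 2 ∧ bA 2 = bf 2) :
    IsParamodularAwayFrom A 277 f :=
  paramodular_of_surfaceConjCertificate_holds hC hframe aA bA af bf hA hρf hcusp hne hfe (fun _ => h2)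

end Literature.NumberTheory.FaltingsSerre.Paramodular277

end
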